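import Summits.Parity.BatemanHorn.Theses.AlmostPrimeZeros
import Summits.Parity.BatemanHorn.Theorems.AlmostPrimeZerosSystemZeroRepulsionPerSystem
import Summits.Parity.BatemanHorn.Theorems.AlmostPrimeZerosSystemZeroRepulsionLinearClass
import Summits.Parity.BatemanHorn.Theorems.AlmostPrimeZerosSystemZeroRepulsionFarMomentBoundedTilt
import Summits.Parity.BatemanHorn.Theorems.AlmostPrimeZerosDiscMajorantLogRealAxisFixedInterval
import Literature.NumberTheory.Sieve.BatemanHornProofs

/-!
# Line `smooth-rough-lattice-acquisition` (reshaped: NearFar) — skeleton v6 for the crux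
`AlmostPrimeZeros.SystemZeroRepulsion` (item stmt-Parity-11291, rank 2 of route-Parity-AlmostPrimeZeros)

Crux (FIXED, by name): for every Bateman–Horn system `f = (f₁,…,f_k)` there is `C_f` with
`T_f(x) := Σ_ρ ‖1 − ρ‖⁻² ≤ C_f` for all `x ≥ 2`, the sum over the roots (with multiplicity) of the
almost-prime polynomial `S_x(z) = Σ_{0 ≤ n ≤ x} z^{s_f(n)}`, `s_f(n) = Σ_i Σ_{p^v ∥ f_i(n)} min(v,2)`.
Notation: `L = log log x`.

## Skeleton v6 (lead c5, 2026-08-17): the crux's stubs ARE the leaves' registered open stubs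

History in one paragraph (details: `Cruxes/SystemZeroRepulsion/{STRATEGY-CENSUS.md, NOTES.md, PICKED.md,
FAR-BUDGET-c4.md}`).  Three planned lines died at their parity joints (four leads); the strategist cut the
crux into the near leaf `DiscMajorantLog` (stmt-Parity-17114) and the far leaf `FarMomentWide`
(stmt-Parity-17115) with the glue landed (`Reduction.SystemZeroRepulsion_of_discMajorantLog_of_farMomentWide`,
p96203; item stmt-Parity-17116 CLOSED); leads c2–c4 made the cut class-by-class (skeletons v2–v5): the
linear class `k = 1, deg f ≤ 1` is CLOSED (`stub_linearClassRepulsion`, p146288: Selberg–Delange in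
progressions with `R ≍ L`), the far moment at BOUNDED tilt is CLOSED for all systems
(`stub_farMomentBoundedTilt`, p150302: Nair–Tenenbaum-light), and v5 kept three beyond-class stubs
(growing far tilt; right half-disc; left half-disc), each returned `stub-blocked` on a named missing fact.
Meanwhile the near leaf's own lead (c1 of stmt-Parity-17114, skeleton `Cruxes/DiscMajorantLog/Lines/Sketch.lean`
rev 3) cut ITS right half-disc into the positive real axis on FIXED intervals — now a THEOREM for ALL
systems (`DiscMajorantLog.Sketch.stub_realAxisFixedInterval`, p150589, imported here) — the positive real
axis at GROWING tilt (`stub_realAxisGrowing`), and the closed right half-disc OFF the positive axis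
(`stub_rightOffAxis`), keeping the left half-disc (`stub_leftHalfDiscMajorantLog`).

v6 = v5 with the two near stubs REPLACED by those three registered stubs of the near leaf, with
byte-identical names and signatures (all systems; the linear class is closed anyway, so restricting them
to the beyond class would only fork the signatures), and the far stub kept as
`stub_farMomentWide_beyond_growing` (= `FarMomentWide` on the open class at growing tilt).  So the crux
now has NO stub of its own: every registered stub below is, verbatim, a registered open stub of
stmt-Parity-17114 or the open conjunct of stmt-Parity-17115, and a landing on a leaf closes the same
`sorry` here by import.  The composition `SystemZeroRepulsion_of` is sorry-free: right half-disc from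
R-fixed (imported) + R-growing + A (`rightHalf_of_parts`, the near lead's glue transplanted), whole disc by
`discMajorantLog_of_halves_stat`, far moment by `farMomentWide_beyond_of_parts`, crux by
`repulsionStat_of_discMajorantLog_of_moment` + `crux_conclusion_of_stat_bound`; linear class by
`stub_linearClassRepulsion`.

What each open stub IS (so that nobody re-derives it): R-growing = Poisson-sharp upper tails
`#{n ≤ x : s_f(n) ≥ m} ≤ A x e^{−kL}(kL)^m/m!·e^{C t log(t+2)}` for `m ≤ 3kL² + kL` along the system — open
ANATOMY for every `Σ deg ≥ 2` (level-`x` visible-divisor certificates fail through the blind-spot event of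
`Cruxes/DiscMajorantLog/ATLAS-ideator-k1.md` §3.3: an abnormally friable visible part `d ∈ (x^{1−1/u}, x]`
followed by `≍ (Σdeg−1)u` invisible primes just above `x^{1/u}`; a sieve on the short progression
`n ≡ a (d)` certifies only the ABSENCE of primes `< x^{1/2u}`, never their presence); A = Halász-type decay
of `Σ_n z^{s_f(n)}` along the system off the axis, LPF-law-complete (ATLAS §2: not forced by Type-I data of
level `x^{1−ε}` plus the exact Hooley 2-fibre); P = tilted Chowla/Elliott along the system with saving
`(log x)^{2k|Re z|}` (summit-class; `liouvilleSaving_of_discMajorant` p96296, `twinExclusion`); far =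
Hardy–Ramanujan tails along the system up to `m ≍ log x/L^{3/2}` (FAR-BUDGET-c4: no level-`x` budget is
admissible in the Jensen tail).  Known class for all four: `k ≤ 1, deg ≤ 1` (closed).

Disproof.lean v6 (crux, 2026-08-16T05:25Z) and the near leaf's Disproof v3 honoured: constants quantified
after `(k, f)` (`not_uniformConstant`); no zero-free disc uniform in the system
(`exists_system_root_near_one`); `2 ≤ x` unused (`withoutXGeTwo_iff`); all four `IsBatemanHornSystem`
clauses kept on every stub (Negative/ p76305 family, p136416/p140268/p141187; `WithoutSystem` is false,
rattack-14760); no `abs`/triangle-inequality route off the positive axis (`not_abs`) — the composition uses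
`‖Σ (t:ℂ)^{s}‖ = Σ t^{s}` on the positive axis only.
-/

noncomputable section

namespace Summit.Parity.BatemanHorn.Cruxes.SystemZeroRepulsion.NearFar

open scoped BigOperators
open Polynomial
open Summit.Parity.BatemanHorn.Theses.AlmostPrimeZeros

/-! ## The registered stubs -/

/-! LANDED stubs of this skeleton (imported above, no `sorry`): `stub_shiftTiltedMajorant` (class `lin₁`:
tilted majorant of the shifted capped statistic `s((n+h)⁺)`, p138649 + part 2), `stub_linearRankinMajorant`
(classes `lin₁`/`linₐ`: Rankin moment along `aX + b`, p138681); glue `stub_nearZoneStat` (p137550),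
`stub_farZoneStat` (p137552), `stub_repulsionStat`/`stub_repulsionOfTiltedStat` (PerSystem). -/

/-! ### Class `linₐ` (`k = 1`, `f = aX + b`, `a ≥ 2`) — LANDED (skeleton v4, 2026-08-17)

The one-sided Selberg–Delange majorant in an arithmetic progression `apTiltedMajorant` is a THEOREM of
the tree (`Theorems/AlmostPrimeZerosSystemZeroRepulsionLinearClass.lean`), composed by name from the
landed registered stubs A `stub_apTwistedEulerData` (p142404, + Core p141679), C `stub_apLogL` (p141561),
D `stub_apHolRieszBound` (p142409, + Core p141618), E `stub_apTiltedAssembly` (p145382; helpers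
`stub_apCharBoundPrincipal` p142977, `stub_apCharBoundNonprincipal` p143730, `stub_apTiltedReindex`
p143444, `stub_apProgressionSum` p144567) — every analytic input supplied by the tree's Dirichlet
L-function library (ZFR MV Thm 11.3, `L'/L` bounds MV Thm 11.4, Selberg's capped factors, Perron/Riesz
means, rectangle contours).  With `stub_shiftTiltedMajorant` (p140641), `stub_linearRankinMajorant`
(p138681) and the glue `stub_repulsionOfTiltedStat` (p140663) this CLOSES the crux on every linear system:
`stub_linearClassRepulsion` / `SystemZeroRepulsion_linearClass` (imported). -/

/-! LANDED (skeleton v5): `stub_farMomentBoundedTilt` — far moment at bounded tilt `1 ≤ t ≤ T₀`, ALL systems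
(`Theorems/AlmostPrimeZerosSystemZeroRepulsionFarMomentBoundedTilt.lean`, imported above; from the Nair–Tenenbaum-light
uniform bound of crux stmt-Parity-11292 and `tL + t²/L ≥ 2t`). -/

/-- STUB (class `beyond`; the OPEN part of the far leaf `FarMomentWide`, item stmt-Parity-17115, restricted to the
systems NOT covered by the landed `stub_farMomentWide_linear`; parity-free ANATOMY) **wide exponential moment along
the system at GROWING tilt**: for a Bateman–Horn system with `k ≠ 1` or some `deg f_i ≥ 2` there are a threshold
`T₀ ≥ 1` and `C` with `Σ_{n≤x} t^{s_f(n)} ≤ (x+1)·exp(C(t·log log x + t²/log log x))` for all `x ≥ 3` and all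
`T₀ ≤ t ≤ √log x`.  (`k = 0`: trivially `T₀ = 1`, `C = 0`.)  Equivalent (elementary, lead c3 memo) to the two-regime
tail profile `#{n≤x : s_f(n)=m} ≤ (x+1)(e²CL/m)^m` for `m ≤ CL³` and `≤ (x+1)(2eC/(mL))^{m/2}` beyond, `L = log log x`
(sufficiency kernel-checked: `NearFar.farMomentWide_of_tailProfile`, `Theorems/…FarMomentTailProfile.lean`);
level-`x` certificates give budgets `O(t³)` (worst-case cofactor) / `O(t² log t)` (cofactor half-certified), the Jensen
far zone needs `t²/L`.  First cases: irreducible quadratics, `(X, X+h)`. -/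
theorem stub_farMomentWide_beyond_growing :
    ∀ (k : ℕ) (f : Fin k → Polynomial ℤ), Literature.NumberTheory.Sieve.IsBatemanHornSystem f →
      (k ≠ 1 ∨ ∃ i, 2 ≤ (f i).natDegree) →
      ∃ T₀ : ℝ, 1 ≤ T₀ ∧ ∃ C : ℝ, ∀ x : ℕ, 3 ≤ x → ∀ t : ℝ, T₀ ≤ t → t ≤ Real.sqrt (Real.log (x : ℝ)) →
        (∑ n ∈ Finset.range (x + 1),
            (t : ℝ) ^ (∑ i, (((f i).eval (n : ℤ)).toNat.factorization.sum fun _ v => min v 2))) ≤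
          ((x : ℝ) + 1) *
            Real.exp (C * (t * Real.log (Real.log (x : ℝ)) + t ^ 2 / Real.log (Real.log (x : ℝ)))) := by
  sorry

/-- GLUE (sorry-free): the v4 far statement on the beyond class (`1 ≤ t ≤ √log x`) from the bounded-tilt stub (with the
threshold `T₀` of the growing stub) and the growing-tilt stub — `C = max C₁ C₂`, the budget `tL + t²/L` being `≥ 0`
for `x ≥ 3`, `t ≥ 1`. -/
theorem farMomentWide_beyond_of_parts :
    ∀ (k : ℕ) (f : Fin k → Polynomial ℤ), Literature.NumberTheory.Sieve.IsBatemanHornSystem f →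
      (k ≠ 1 ∨ ∃ i, 2 ≤ (f i).natDegree) →
      ∃ C : ℝ, ∀ x : ℕ, 3 ≤ x → ∀ t : ℝ, 1 ≤ t → t ≤ Real.sqrt (Real.log (x : ℝ)) →
        (∑ n ∈ Finset.range (x + 1),
            (t : ℝ) ^ (∑ i, (((f i).eval (n : ℤ)).toNat.factorization.sum fun _ v => min v 2))) ≤
          ((x : ℝ) + 1) *
            Real.exp (C * (t * Real.log (Real.log (x : ℝ)) + t ^ 2 / Real.log (Real.log (x : ℝ)))) := by
  intro k f hf hB
  obtain ⟨T₀, hT₀, C₁, h₁⟩ := stub_farMomentWide_beyond_growing k f hf hB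
  obtain ⟨C₂, h₂⟩ := stub_farMomentBoundedTilt k f hf T₀ hT₀
  refine ⟨max C₁ C₂, fun x hx t ht1 ht2 => ?_⟩
  -- the budget is nonnegative: `L = log log x > 0` for `x ≥ 3` (as `e < 3`)
  have hx3 : (3 : ℝ) ≤ x := by exact_mod_cast hx
  have hL : 0 < Real.log (Real.log (x : ℝ)) := by
    apply Real.log_pos
    rw [Real.lt_log_iff_exp_lt (by linarith)]
    exact Real.exp_one_lt_d9.trans_le (by norm_num; linarith)
  have hb : 0 ≤ t * Real.log (Real.log (x : ℝ)) + t ^ 2 / Real.log (Real.log (x : ℝ)) :=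
    add_nonneg (mul_nonneg (by linarith) hL.le) (div_nonneg (sq_nonneg _) hL.le)
  have hx1 : (0 : ℝ) ≤ (x : ℝ) + 1 := by positivity
  rcases le_total t T₀ with htT | hTt
  · refine (h₂ x hx t ht1 htT).trans ?_
    exact mul_le_mul_of_nonneg_left (Real.exp_le_exp.2 (mul_le_mul_of_nonneg_right (le_max_right _ _) hb)) hx1
  · refine (h₁ x hx t hTt ht2).trans ?_
    exact mul_le_mul_of_nonneg_left (Real.exp_le_exp.2 (mul_le_mul_of_nonneg_right (le_max_left _ _) hb)) hx1

/-! ### The near leaf's registered cut (stmt-Parity-17114, `Cruxes/DiscMajorantLog/Lines/Sketch.lean` rev 3)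

Names and signatures below are BYTE-IDENTICAL to the near leaf's registered stubs; R-fixed
(`DiscMajorantLog.Sketch.stub_realAxisFixedInterval`, p150589) is imported, not restated. -/

/-- **Stub R-growing (positive real segment at growing `t`, ALL systems)** — registered stub of the near
leaf stmt-Parity-17114, verbatim.  For every Bateman–Horn system there are `T₀ ≥ 1`, `A, C, x₀` with
`Σ_{0≤n≤x} t^{s_f(n)} ≤ A·x·(log x)^{k(t−1)}·exp(C (t−1) log((t−1)+2))` for all `x ≥ x₀` and
`T₀ ≤ t ≤ 1 + 3 log log x`.  By Legendre duality this is Hardy–Ramanujan at Poisson precision along the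
system for `m ≤ 3k(log log x)² + k log log x`: OPEN anatomy for every system with `Σ deg f_i ≥ 2` (blind-spot
event, ATLAS-ideator-k1 §3.3); known for `k ≤ 1`, `deg ≤ 1` (`DiscMajorantLog.Sketch.linearClass`). -/
theorem stub_realAxisGrowing :
    ∀ (k : ℕ) (f : Fin k → Polynomial ℤ), Literature.NumberTheory.Sieve.IsBatemanHornSystem f →
      ∃ T₀ : ℝ, 1 ≤ T₀ ∧ ∃ A C : ℝ, ∃ x₀ : ℕ, ∀ x : ℕ, x₀ ≤ x → ∀ t : ℝ, T₀ ≤ t →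
        t - 1 ≤ 3 * Real.log (Real.log (x : ℝ)) →
        (∑ n ∈ Finset.range (x + 1), t ^ (∑ i, (((f i).eval (n : ℤ)).toNat.factorization.sum fun _ v => min v 2))) ≤
          A * (x : ℝ) * (Real.log (x : ℝ)) ^ ((k : ℝ) * (t - 1)) *
            Real.exp (C * (t - 1) * Real.log ((t - 1) + 2)) := by
  sorry

/-- **Stub A (closed right half-disc off the positive axis, ALL systems)** — registered stub of the near
leaf stmt-Parity-17114, verbatim.  The crux's bound for `x ≥ x₀`, `‖z − 1‖ ≤ 3 log log x`, `0 ≤ Re z`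
and `z ∉ (0, ∞)`: Halász-type decay of `Σ_n z^{s_f(n)}` along `f` off the axis.  OPEN for every system
outside `k ≤ 1`, `deg ≤ 1` (ATLAS-ideator-k1 §2: LPF-law-complete, not forced by Type-I data + the exact
Hooley 2-fibre); twin-blind, so no parity argument refutes it. -/
theorem stub_rightOffAxis :
    ∀ (k : ℕ) (f : Fin k → Polynomial ℤ), Literature.NumberTheory.Sieve.IsBatemanHornSystem f →
      ∃ A C : ℝ, ∃ x₀ : ℕ, ∀ x : ℕ, x₀ ≤ x → ∀ z : ℂ, ‖z - 1‖ ≤ 3 * Real.log (Real.log (x : ℝ)) →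
        0 ≤ z.re → ¬ (z.im = 0 ∧ 0 < z.re) →
        ‖(∑ n ∈ Finset.range (x + 1), (z : ℂ) ^ (∑ i, (((f i).eval (n : ℤ)).toNat.factorization.sum fun _ v => min v 2)))‖ ≤
          A * (x : ℝ) * (Real.log (x : ℝ)) ^ ((k : ℝ) * ((z : ℂ).re - 1)) *
            Real.exp (C * ‖(z : ℂ) - 1‖ * Real.log (‖(z : ℂ) - 1‖ + 2)) := by
  sorry

/-- **Stub P (open left half-disc `Re z < 0`, ALL systems)** — registered stub of the near leaf
stmt-Parity-17114, verbatim; THE PARITY CONTENT of the crux.  The crux's bound for `x ≥ x₀`,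
`‖z − 1‖ ≤ 3 log log x` and `Re z < 0` (tilted Chowla/Elliott along `f`; at `z = −1` it is
`|Σ_{n≤x} (−1)^{s_f(n)}| ≤ A' x (log x)^{−2k}`, cf. `liouvilleSaving_of_discMajorant` p96296 and
`twinExclusion`).  Known: `k = 0`; `k = 1`, `deg f ≤ 1`.  OPEN (summit-class) for every system with
`k ≥ 2` or some `deg f_i ≥ 2`. -/
theorem stub_leftHalfDiscMajorantLog :
    ∀ (k : ℕ) (f : Fin k → Polynomial ℤ), Literature.NumberTheory.Sieve.IsBatemanHornSystem f →
      ∃ A C : ℝ, ∃ x₀ : ℕ, ∀ x : ℕ, x₀ ≤ x → ∀ z : ℂ, ‖z - 1‖ ≤ 3 * Real.log (Real.log (x : ℝ)) →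
        z.re < 0 →
        ‖(∑ n ∈ Finset.range (x + 1), (z : ℂ) ^ (∑ i, (((f i).eval (n : ℤ)).toNat.factorization.sum fun _ v => min v 2)))‖ ≤
          A * (x : ℝ) * (Real.log (x : ℝ)) ^ ((k : ℝ) * ((z : ℂ).re - 1)) *
            Real.exp (C * ‖(z : ℂ) - 1‖ * Real.log (‖(z : ℂ) - 1‖ + 2)) := by
  sorry

/-! ### Glue for the right half-disc (sorry-free; transplanted from the near lead's `rightHalf_of_stubs`) -/

/-- Monotonicity of the majorant in its two constants: if `A ≤ A'`, `C ≤ C'` and `A' ≥ 0`, then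
`A·P·e^{C r log(r+2)} ≤ A'·P·e^{C' r log(r+2)}` for `P ≥ 0`, `r ≥ 0`. -/
theorem majorant_mono {A A' C C' P r : ℝ} (hA : A ≤ A') (hA' : 0 ≤ A') (hC : C ≤ C') (hP : 0 ≤ P)
    (hr : 0 ≤ r) :
    A * P * Real.exp (C * r * Real.log (r + 2)) ≤ A' * P * Real.exp (C' * r * Real.log (r + 2)) := by
  -- adapted from Cruxes/DiscMajorantLog/Lines/Sketch.lean (lead c1 of stmt-Parity-17114)
  have hrl : 0 ≤ r * Real.log (r + 2) := mul_nonneg hr (Real.log_nonneg (by linarith))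
  have hexp : Real.exp (C * r * Real.log (r + 2)) ≤ Real.exp (C' * r * Real.log (r + 2)) := by
    apply Real.exp_le_exp.2
    have : C * (r * Real.log (r + 2)) ≤ C' * (r * Real.log (r + 2)) :=
      mul_le_mul_of_nonneg_right hC hrl
    simpa [mul_assoc] using this
  calc A * P * Real.exp (C * r * Real.log (r + 2))
      ≤ A' * P * Real.exp (C * r * Real.log (r + 2)) := by
        gcongr
    _ ≤ A' * P * Real.exp (C' * r * Real.log (r + 2)) :=
        mul_le_mul_of_nonneg_left hexp (mul_nonneg hA' hP)

/-- On the positive real axis the statistic is a sum of nonnegative reals: for `t ≥ 0`,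
`‖Σ_n (t:ℂ)^{e n}‖ = Σ_n t^{e n}`. -/
theorem norm_sum_ofReal_pow (t : ℝ) (ht : 0 ≤ t) (s : Finset ℕ) (e : ℕ → ℕ) :
    ‖∑ n ∈ s, ((t : ℂ)) ^ (e n)‖ = ∑ n ∈ s, t ^ (e n) := by
  have h : (∑ n ∈ s, ((t : ℂ)) ^ (e n)) = ((∑ n ∈ s, t ^ (e n) : ℝ) : ℂ) := by push_cast; rfl
  rw [h, Complex.norm_real, Real.norm_eq_abs,
    abs_of_nonneg (Finset.sum_nonneg fun n _ => pow_nonneg ht _)]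

/-- A complex number with zero imaginary part is the cast of its real part. -/
theorem eq_ofReal_of_im_eq_zero {z : ℂ} (h : z.im = 0) : z = ((z.re : ℝ) : ℂ) :=
  Complex.ext (by simp) (by simp [h])

/-- **The right half-disc `Re z ≥ 0` from its three parts (R-fixed imported, R-growing, A), ALL systems.**
On the positive axis `z = t > 0` the sum is `Σ t^{s_f(n)}` and `‖z − 1‖ = |t − 1|`; use R-fixed for
`t ≤ T₀` (the budget factor is `≥ 1` once `C ≥ 0`) and R-growing for `t > T₀` (there `|t − 1| = t − 1`);
off the axis use A.  Constants `max`-ed, `x₀ ≥ 2`. -/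
theorem rightHalf_of_parts :
    ∀ (k : ℕ) (f : Fin k → Polynomial ℤ), Literature.NumberTheory.Sieve.IsBatemanHornSystem f →
      ∃ A C : ℝ, ∃ x₀ : ℕ, ∀ x : ℕ, x₀ ≤ x → ∀ z : ℂ, ‖z - 1‖ ≤ 3 * Real.log (Real.log (x : ℝ)) →
        0 ≤ z.re →
        ‖(∑ n ∈ Finset.range (x + 1), (z : ℂ) ^ (∑ i, (((f i).eval (n : ℤ)).toNat.factorization.sum fun _ v => min v 2)))‖ ≤
          A * (x : ℝ) * (Real.log (x : ℝ)) ^ ((k : ℝ) * ((z : ℂ).re - 1)) *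
            Real.exp (C * ‖(z : ℂ) - 1‖ * Real.log (‖(z : ℂ) - 1‖ + 2)) := by
  -- adapted from Cruxes/DiscMajorantLog/Lines/Sketch.lean `rightHalf_of_stubs` (lead c1 of stmt-Parity-17114)
  intro k f hf
  obtain ⟨T₀, hT₀, A₂, C₂, x₂, hgrow⟩ := stub_realAxisGrowing k f hf
  obtain ⟨A₁, x₁, hfix⟩ :=
    Summit.Parity.BatemanHorn.Cruxes.DiscMajorantLog.Sketch.stub_realAxisFixedInterval k f hf T₀ hT₀
  obtain ⟨A₃, C₃, x₃, hoff⟩ := stub_rightOffAxis k f hf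
  refine ⟨max (max (max A₁ A₂) A₃) 0, max (max C₂ C₃) 0, max (max (max x₁ x₂) x₃) 2,
    fun x hx z hz hre => ?_⟩
  have hx₁ : x₁ ≤ x := le_trans (le_trans (le_trans (le_max_left _ _) (le_max_left _ _)) (le_max_left _ _)) hx
  have hx₂ : x₂ ≤ x := le_trans (le_trans (le_trans (le_max_right _ _) (le_max_left _ _)) (le_max_left _ _)) hx
  have hx₃ : x₃ ≤ x := le_trans (le_trans (le_max_right _ _) (le_max_left _ _)) hx
  have hx2 : (2 : ℝ) ≤ x := by exact_mod_cast (le_max_right _ _).trans hx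
  have hlogx : 0 < Real.log (x : ℝ) := Real.log_pos (by linarith)
  have hA' : 0 ≤ max (max (max A₁ A₂) A₃) 0 := le_max_right _ _
  have hC' : 0 ≤ max (max C₂ C₃) 0 := le_max_right _ _
  have hr : 0 ≤ ‖(z : ℂ) - 1‖ := norm_nonneg _
  have hP : 0 ≤ (x : ℝ) * (Real.log (x : ℝ)) ^ ((k : ℝ) * ((z : ℂ).re - 1)) :=
    mul_nonneg (by positivity) (Real.rpow_nonneg hlogx.le _)
  set N : ℕ → ℕ := fun n => ∑ i, (((f i).eval (n : ℤ)).toNat.factorization.sum fun _ v => min v 2)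
    with hNdef
  by_cases hax : z.im = 0 ∧ 0 < z.re
  · -- the positive real axis: `z = t`
    obtain ⟨him, htpos⟩ := hax
    set t : ℝ := z.re with htdef
    have hzt : z = ((t : ℝ) : ℂ) := eq_ofReal_of_im_eq_zero him
    have hsum : ‖∑ n ∈ Finset.range (x + 1), (z : ℂ) ^ N n‖ = ∑ n ∈ Finset.range (x + 1), t ^ N n := by
      rw [hzt]; exact norm_sum_ofReal_pow t htpos.le _ _
    have hnorm : ‖(z : ℂ) - 1‖ = |t - 1| := by
      rw [hzt, show ((t : ℝ) : ℂ) - 1 = ((t - 1 : ℝ) : ℂ) by push_cast; ring, Complex.norm_real,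
        Real.norm_eq_abs]
    rw [hsum]
    by_cases htT : t ≤ T₀
    · -- fixed interval (imported theorem, all systems)
      have h1 := hfix x hx₁ t htpos htT
      calc ∑ n ∈ Finset.range (x + 1), t ^ N n
          ≤ A₁ * (x : ℝ) * (Real.log (x : ℝ)) ^ ((k : ℝ) * (t - 1)) := h1
        _ = A₁ * ((x : ℝ) * (Real.log (x : ℝ)) ^ ((k : ℝ) * ((z : ℂ).re - 1))) *
              Real.exp (0 * ‖(z : ℂ) - 1‖ * Real.log (‖(z : ℂ) - 1‖ + 2)) := by
            rw [htdef]; simp [mul_assoc]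
        _ ≤ max (max (max A₁ A₂) A₃) 0 * ((x : ℝ) * (Real.log (x : ℝ)) ^ ((k : ℝ) * ((z : ℂ).re - 1))) *
              Real.exp (max (max C₂ C₃) 0 * ‖(z : ℂ) - 1‖ * Real.log (‖(z : ℂ) - 1‖ + 2)) :=
            majorant_mono (le_trans (le_trans (le_max_left _ _) (le_max_left _ _)) (le_max_left _ _))
              hA' hC' hP hr
        _ = _ := by ring
    · -- growing `t`
      have hT₀t : T₀ ≤ t := le_of_lt (lt_of_not_ge htT)
      have ht1 : 0 ≤ t - 1 := by linarith
      have habs : |t - 1| = t - 1 := abs_of_nonneg ht1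
      have hz' : t - 1 ≤ 3 * Real.log (Real.log (x : ℝ)) := by rw [← habs, ← hnorm]; exact hz
      have h2 := hgrow x hx₂ t hT₀t hz'
      calc ∑ n ∈ Finset.range (x + 1), t ^ N n
          ≤ A₂ * (x : ℝ) * (Real.log (x : ℝ)) ^ ((k : ℝ) * (t - 1)) *
              Real.exp (C₂ * (t - 1) * Real.log ((t - 1) + 2)) := h2
        _ = A₂ * ((x : ℝ) * (Real.log (x : ℝ)) ^ ((k : ℝ) * ((z : ℂ).re - 1))) *
              Real.exp (C₂ * ‖(z : ℂ) - 1‖ * Real.log (‖(z : ℂ) - 1‖ + 2)) := by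
            rw [hnorm, habs, htdef]; ring
        _ ≤ max (max (max A₁ A₂) A₃) 0 * ((x : ℝ) * (Real.log (x : ℝ)) ^ ((k : ℝ) * ((z : ℂ).re - 1))) *
              Real.exp (max (max C₂ C₃) 0 * ‖(z : ℂ) - 1‖ * Real.log (‖(z : ℂ) - 1‖ + 2)) :=
            majorant_mono (le_trans (le_trans (le_max_right _ _) (le_max_left _ _)) (le_max_left _ _))
              hA' ((le_max_left _ _).trans (le_max_left _ _)) hP hr
        _ = _ := by ring
  · -- off the positive axis
    have h3 := hoff x hx₃ z hz hre hax
    calc ‖∑ n ∈ Finset.range (x + 1), (z : ℂ) ^ N n‖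
        ≤ A₃ * (x : ℝ) * (Real.log (x : ℝ)) ^ ((k : ℝ) * ((z : ℂ).re - 1)) *
            Real.exp (C₃ * ‖(z : ℂ) - 1‖ * Real.log (‖(z : ℂ) - 1‖ + 2)) := h3
      _ = A₃ * ((x : ℝ) * (Real.log (x : ℝ)) ^ ((k : ℝ) * ((z : ℂ).re - 1))) *
            Real.exp (C₃ * ‖(z : ℂ) - 1‖ * Real.log (‖(z : ℂ) - 1‖ + 2)) := by ring
      _ ≤ max (max (max A₁ A₂) A₃) 0 * ((x : ℝ) * (Real.log (x : ℝ)) ^ ((k : ℝ) * ((z : ℂ).re - 1))) *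
            Real.exp (max (max C₂ C₃) 0 * ‖(z : ℂ) - 1‖ * Real.log (‖(z : ℂ) - 1‖ + 2)) :=
          majorant_mono ((le_max_right _ _).trans (le_max_left _ _)) hA'
            ((le_max_right _ _).trans (le_max_left _ _)) hP hr
      _ = _ := by ring

/-! ## The composition (sorry-free; glue `crux_conclusion_of_stat_bound`, `stub_linearClassRepulsion`
imported from `…LinearClass.lean`, `discMajorantLog_of_halves_stat` / `repulsionStat_of_discMajorantLog_of_moment`
from `…PerSystem.lean`) -/

/-- **`SystemZeroRepulsion` from the reshaped line, skeleton v6** (kernel-checked composition; no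
`sorry` of its own; the `sorry`s are exactly the four open registered stubs above — growing far tilt on
the beyond class, and the near leaf's R-growing / A / P; R-fixed, the bounded far tilt and the linear
class are imported theorems).  Class split on the Bateman–Horn system: `k = 1, deg f ≤ 1` by
`stub_linearClassRepulsion`; `beyond` (k ≠ 1 or some deg ≥ 2) through the right half-disc glue
`rightHalf_of_parts`, the `Re z = 0` cut `discMajorantLog_of_halves_stat` and the two-hypothesis
reduction `repulsionStat_of_discMajorantLog_of_moment`. -/
theorem SystemZeroRepulsion_of : SystemZeroRepulsion := by
  intro k f hf
  by_cases hcls : k = 1 ∧ ∀ i, (f i).natDegree ≤ 1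
  · -- the linear classes: LANDED (`stub_linearClassRepulsion`)
    obtain ⟨rfl, hdeg⟩ := hcls
    exact stub_linearClassRepulsion f hf (hdeg 0)
  · -- class beyond
    have hB : k ≠ 1 ∨ ∃ i, 2 ≤ (f i).natDegree := by
      by_cases hk : k = 1
      · right
        by_contra hne
        push Not at hne
        exact hcls ⟨hk, fun i => Nat.le_of_lt_succ (hne i)⟩
      · exact Or.inl hk
    refine crux_conclusion_of_stat_bound f rfl
      (repulsionStat_of_discMajorantLog_of_moment _ k ?_ ?_)
    · exact discMajorantLog_of_halves_stat _ k
        (rightHalf_of_parts k f hf) (stub_leftHalfDiscMajorantLog k f hf)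
    · obtain ⟨C, hC⟩ := farMomentWide_beyond_of_parts k f hf hB
      exact ⟨C, 0, fun x _ hx3 t ht1 ht2 => hC x hx3 t ht1 ht2⟩

end Summit.Parity.BatemanHorn.Cruxes.SystemZeroRepulsion.NearFar

end
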